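import Summits.BirchSwinnertonDyer.Rank1Residual.X11b.BDPRouteOpenInputTight
import Summits.BirchSwinnertonDyer.Rank1Residual.X11b.BDPRouteOpenInputSplit
import HarnessLib

/-!
# Class X11b, route p2 at `p ≥ 5`: THE OPEN INPUT AT ITS WEAKEST IN THE DATUM DIRECTION (I) — the
# composite open input demanded at the p2-data over ONE admissible Heegner field `K` (not over all
# of them) already gives the records, and on the Locus the input over ANY admissible field is
# EQUIVALENT to `BSD(E,p)`, hence to the input over EVERY field (cell `b2b-bsdres`, sub-cell
# `multr1-p2`, gen 27; file 1 of 3: `…Field` / `…FieldSupply` / `…FieldPrint`)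

HONEST FRAMING (cell `b2b-bsdres`, run/shared/lean/b2b/bsd-rank1-residual/, verbatim in every
file): the goal of the cell is to DELETE the COMBINATION-SHAPED residual classes of the
Birch–Swinnerton-Dyer formula for ALL analytic-rank `≤ 1` elliptic curves over `ℚ` — "full BSD
formula for every rank `≤ 1` curve in class `C`" assembled STRICTLY from published theorems — so
that the rank-`≤ 1` remainder becomes exactly the CONSTRUCTION-SHAPED classes, which are TYPED
(missing-input `Prop`s), NOT attempted. This is not "finishing BSD". Sub-cell `multr1-p2` is a
RESEARCH ROUTE on class X11b (`ClassX11b W p := r_an = 1 ∧ p ≠ 2 ∧ mult(p) ∧ irr(p)`); no claim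
beyond the stated class and loci; X11b's label does not change; NOTHING is booked by this file.

## Why (the observation of gen 27)

Every typed shape of route p2 since gen 11 (`P2OpenInputOnTreeAt`, gen 24's H∃♭, gen 25's (2.4)∃♭ /
value∃♭, gen 26's ∀-shapes) quantifies over ALL p2-data of the pair `(E, p)`, in particular over
EVERY imaginary quadratic `K` with `d_K` odd, `p ∤ d_K`, `p ∤ w_K`, every `ℓ ∣ N_E` split in `K`,
`L(E^{d_K}, 1) ≠ 0`. But the route CONSUMES the input at ONE datum: gen 18's
`P2.missingLowerBoundAt_of_openInputAt` picks a Hoffstein–Luo field and never looks at another. A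
refereed source for the anticyclotomic main conjecture at `p ∥ N` will carry ITS OWN hypotheses on
`K` (`(d_K, Np) = 1`, `2` split, `d_K` odd, `|d_K|` large, …); typed over ALL p2-admissible `K` the
route's input would not be discharged by such a source, although the route needs it at one field
only. Gen 12's maxim — EVERY TYPED INPUT AT ITS WEAKEST — applied in the datum direction.

## What this file proves (THEOREMS plus ONE per-field shape definition — the body of the class-wide
## `P2OpenInputOnTreeAt` (gen 11) VERBATIM with the field `K` a PARAMETER; OPEN exactly as its
## parent; nothing asserted)

* §1 `P2.OpenInputOnTreeAtField W p K`; `P2OpenInputOnTreeAt W p ↔ ∀ K, P2.OpenInputOnTreeAtField W p K`.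
* §2 **`P2.missingLowerBoundAt_of_openInputAtField`**: the main-conjecture half at an X11b ∧ surj
  pair, `p ≥ 5`, from the route's published facts and the composite open input over ONE field `K`
  with (`K` imaginary quadratic, `d_K` odd, `p ∤ d_K`, `p ∤ w_K`, every `ℓ ∣ N_E` split,
  `L(E^{d_K},1) ≠ 0`) — the Manin-good parametrisation, the Heegner point, its non-torsion, the
  minimal model of the twist are CONSTRUCTED (as in gen 18), not asked;
  **`P2.bsdp_of_locus_of_openInputAtField`**: `BSD(E,p)` on the Locus (`(ram) ∧ p ∤ ∏ c_ℓ`,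
  2 093 111 ‖ 61 629 pairs) from published facts + the input over ONE admissible field.
* §3 TIGHTNESS PER FIELD (given the PUB-shaped control identity `P2ControlOnTreeAt`, as in gen 18):
  on the Locus, for EVERY admissible `K`, `P2.OpenInputOnTreeAtField W p K ↔ BSDp W p`
  (`P2.openInputOnTreeAtField_iff_bsdp_of_locus`); hence the input over ONE admissible field is
  EQUIVALENT to the input over ALL fields (`P2.openInputOnTreeAtField_iff_openInputOnTreeAt_of_locus`)
  — the datum-direction analogue of gen 26's "the open statement does not see the frame".

Sequel files: `BDPRouteOpenInputFieldSupply` (Hoffstein–Luo SUPPLIES admissible fields with any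
finite set of split primes, `d_K ≡ 1 (mod 8)`, `|d_K|` large ⇒ records from the input over such
fields only) and `BDPRouteOpenInputFieldPrint` (the same in print currency: (2.4)∃♭ over one field).
CONDITIONAL on the open input (PRE at `p ∥ N`); nothing booked; labels UNCHANGED; X11b stays
CONSTRUCTION-SHAPED.

## References

* [Castella2018] F. Castella, Camb. J. Math. 6 (2018), Thm. 2.3, Thms. 3.1–3.2, §5 (arXiv:1704.06608
  pp. 5, 9, 12). * [Castella2018Erratum] (2.4), Thm. 1.1 (pp. 1, 4).
* [JetchevSkinnerWan2017] §7.4.1 (pp. 30–31). * [Skinner2016PacificMC] Thm. C (§1).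
* [GrossLMS1991] §1 (p. 235) (Heegner hypothesis: every `ℓ ∣ N` split). * [Mazur1978] Cor. 4.1.
-/

noncomputable section

open scoped Classical NumberField

open WeierstrassCurve NumberField IsDedekindDomain Field PowerSeries
open Literature.NumberTheory.EllipticCurves Literature.NumberTheory.EllipticCurves.GreenbergSelmer
  Literature.NumberTheory.EllipticCurves.ModularForms
  Literature.NumberTheory.EllipticCurves.Rank1Residual
  Literature.NumberTheory.EllipticCurves.Rank1Residual.Typed
  Literature.NumberTheory.EllipticCurves.Wuthrich2014
  Literature.NumberTheory.EllipticCurves.Castella2018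
  Literature.NumberTheory.EllipticCurves.BalakrishnanEtAl2019
  Literature.NumberTheory.QuadraticFields.Quadratic
  Literature.NumberTheory.Automorphic
  Literature.NumberTheory.GaloisRepresentations Literature.NumberTheory.GaloisCohomology
  Summit.BirchSwinnertonDyer.Rank1Residual.X11b.AcSelmer
  Summit.BirchSwinnertonDyer.Rank1Residual.X11b.LocBridge
  Summit.BirchSwinnertonDyer.Rank1Residual.X11b.CongruenceLimit
  Summit.BirchSwinnertonDyer.Rank1Residual.X11b.Halves

namespace Summit.BirchSwinnertonDyer.Rank1Residual.X11b

/-! ### §1 The composite open input over ONE field -/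

section Shape

variable (W : WeierstrassCurve ℚ) [W.IsElliptic] [W.IsGloballyMinimal] (p : ℕ) [Fact p.Prime]
  (K : Type) [Field K] [NumberField K]

/-- **Route p2's composite open input OVER THE FIELD `K`** — the body of `P2OpenInputOnTreeAt W p`
(gen 11: (IMC≥∘BDP)ᵗ `IMCLowerWaldspurgerOnTreeAt` at every p2-datum, for every anticyclotomic
`κ`, generator `γ`, degree-one `𝔭 ∋ p`, read through THE embedding `embAt`) VERBATIM, with the
imaginary quadratic field `K` a PARAMETER instead of a bound variable: the input is asked at the
p2-data `(N = N_E, Dt, H, ι, P)` OVER `K` only. `P2OpenInputOnTreeAt W p ↔ ∀ K, P2.OpenInputOnTreeAtField W p K`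
(`P2.openInputOnTreeAt_iff_forall_field`). OPEN exactly as its parent (at `p ∥ N`: erratum (2.4) ⇐
[FW21, Thm. 4.41], PREPRINT, composed with Cas18 Thm. 3.2); a predicate, NEVER a theorem here.
[claim: Castella2018Erratum, status: under-review]
[cite: Castella2018, Thm. 3.2 and §5 (5.1) (arXiv:1704.06608 pp. 9, 12) (shape only; nothing asserted)] -/
def P2.OpenInputOnTreeAtField : Prop :=
  ∀ (N : ℕ) [NeZero N] (Dt : ModularParametrizationData W N) (H : HeegnerDatum N (NumberField.discr K))
    (ι : K →+* ℂ) (P : (W.baseChange K).toAffine.Point),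
    ClassX11b W p → 5 ≤ p → Surj W p → W.conductorNorm ℤ = N → IsImaginaryQuadratic K →
    Odd (NumberField.discr K) → ¬ (p : ℤ) ∣ NumberField.discr K → ¬ p ∣ Units.torsionOrder K →
    SatisfiesHeegnerHypothesis N K →
    (W.quadraticTwist (NumberField.discr K : ℚ)).entireLFunction 1 ≠ 0 →
    WeierstrassCurve.Affine.Point.map ι.toRatAlgHom P = heegnerPointComplex Dt H →
    ¬ (p : ℤ) ∣ Dt.c → ¬ IsOfFinAddOrder P →
    ∀ (κ : ZpExtension K p), κ.IsAnticyclotomic →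
      ∀ (γ : Field.absoluteGaloisGroup K) [Fact (κ.IsTopGenerator γ)]
        (𝔭 : HeightOneSpectrum (𝓞 K)) (h𝔭 : ((p : ℕ) : 𝓞 K) ∈ 𝔭.asIdeal)
        (he : 𝔭.asIdeal.ramificationIdx (𝓞 ℚ) = 1) (hf : 𝔭.asIdeal.inertiaDeg (𝓞 ℚ) = 1),
        IMCLowerWaldspurgerOnTreeAt p κ 𝔭 γ (embAt K p 𝔭 h𝔭 he hf) P

variable {W p K}

/-- Class-wide ⟹ per field (instantiate the bound field). [claim: Castella2018Erratum, status: under-review] -/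
theorem P2.openInputOnTreeAtField_of_openInputOnTreeAt (hA : P2OpenInputOnTreeAt W p) :
    P2.OpenInputOnTreeAtField W p K :=
  fun N _ Dt H ι P ↦ hA N K Dt H ι P

variable (W p) in
/-- **Class-wide ⟺ at every field** (binder bookkeeping only). [claim: Castella2018Erratum, status: under-review] -/
theorem P2.openInputOnTreeAt_iff_forall_field :
    P2OpenInputOnTreeAt W p ↔
      ∀ (K : Type) [Field K] [NumberField K], P2.OpenInputOnTreeAtField W p K :=
  ⟨fun hA _ _ _ ↦ P2.openInputOnTreeAtField_of_openInputOnTreeAt hA,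
    fun h N _ K _ _ Dt H ι P ↦ h K N Dt H ι P⟩

end Shape

/-! ### §2 The records from the input over ONE admissible field -/

section OneField

variable (W : WeierstrassCurve ℚ) [W.IsElliptic] [W.IsGloballyMinimal] (p : ℕ) [Fact p.Prime]
  {K : Type} [Field K] [NumberField K]

/-- **THE MAIN-CONJECTURE HALF FROM THE OPEN INPUT OVER ONE ADMISSIBLE FIELD.** For `(E, p) ∈` X11b,
`p ≥ 5`, `ρ̄` onto, and ONE imaginary quadratic `K` with `d_K` odd, `p ∤ d_K`, `p ∤ w_K`, every
`ℓ ∣ N_E` split in `K` and `L(E^{d_K}, 1) ≠ 0`: the route's published facts + the composite open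
input over `K` give `ord_p #Ш(E)_an ≤ ord_p #Ш(E)`. The proof is gen 18's
`P2.missingLowerBoundAt_of_openInputAt` with the Hoffstein–Luo choice of `K` replaced by the given
`K`: the Manin-good parametrisation and Heegner point (`exists_maninDatum_of_odd`, Mazur), the
non-torsion of `P` (Gross–Zagier), the one-sided control (`p2ControlUpperOnTreeAt_of_facts`:
Kolyvagin + Poitou–Tate + local Euler characteristic, a tree theorem on every pair since gen 17), the
minimal model of the twist are supplied here, not asked. CONDITIONAL on the input over `K`.
[cite: Castella2018, Thm. 2.3 (p. 5), Thm. 3.2 (p. 9), §5 (p. 12)] [cite: Castella2018Erratum, (2.4) (p. 4)]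
[cite: JetchevSkinnerWan2017, §7.4.1 (pp. 30–31)] [cite: Wuthrich2014, Prop. 21 (p. 400)]
[cite: Mazur1978, Cor. 4.1] [cite: MilneADT2006, Ch. I, Thm. 4.10(b) and Thm. 2.8] -/
theorem P2.missingLowerBoundAt_of_openInputAtField
    (hGZ : ∀ (N : ℕ) [NeZero N] (W : WeierstrassCurve ℚ) (K : Type) [Field K] [NumberField K],
      gross_zagier N W K)
    (hKo : ∀ (N : ℕ) [NeZero N] (W : WeierstrassCurve ℚ) (K : Type) [Field K] [NumberField K],
      kolyvagin N W K)
    (hWu : sha_dvd_analyticSha)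
    (hGZK : rank_eq_analyticRank_of_analyticRank_le_one) (hmod : hasEntireLFunction_rat)
    (hnf : exists_isNewformOf) (hMaz : mazur_not_dvd_maninConstant_of_odd)
    (hPT : ∀ (K : Type) [Field K] [NumberField K], poitouTate_sum_localTatePairing_eq_zero K)
    (hEP : ∀ (K : Type) [Field K] [NumberField K] (v : HeightOneSpectrum (𝓞 K)),
      localEulerPoincareCharacteristic (v.adicCompletion K))
    -- ONE admissible field
    (hK : IsImaginaryQuadratic K) (hodd : Odd (NumberField.discr K))
    (hpd : ¬ (p : ℤ) ∣ NumberField.discr K) (hμ : ¬ p ∣ Units.torsionOrder K)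
    (hHN : SatisfiesHeegnerHypothesis (W.conductorNorm ℤ) K)
    (hLt : (W.quadraticTwist (NumberField.discr K : ℚ)).entireLFunction 1 ≠ 0)
    -- THE open input, over `K`
    (hA : P2.OpenInputOnTreeAtField W p K)
    (hX : ClassX11b W p) (hp5 : 5 ≤ p) (hsurj : Surj W p) :
    Typed.MissingLowerBoundAt W p := by
  have hNS : integral_neronScaling_of_isGloballyMinimal :=
    integral_neronScaling_of_isGloballyMinimal_holds
  have hLC : P2ControlUpperOnTreeAt W p := p2ControlUpperOnTreeAt_of_facts W p hKo hPT hEP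
  have hX' := hX
  obtain ⟨hr, hp2, hmult, hirr⟩ := hX
  haveI : NeZero (W.conductorNorm ℤ) := ⟨(W.conductorNorm_pos_holds).ne'⟩
  -- the Manin-good parametrisation and the Heegner point over `K`
  obtain ⟨Dt, H, ι, P, hP, hc⟩ :=
    exists_maninDatum_of_odd hnf hMaz hNS W p (W.conductorNorm ℤ) K rfl hp2 hmult hirr hK hHN
  have hPinf : ¬ IsOfFinAddOrder P :=
    not_isOfFinAddOrder_of_heegner_of_analyticRank_eq_one W _ K Dt H ι P (hGZ _ W K) hmod hr hK hHN
      hLt hP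
  -- a globally minimal model of the twist `E^{d_K}`
  have hD0 : (NumberField.discr K : ℚ) ≠ 0 := by exact_mod_cast NumberField.discr_ne_zero K
  haveI hEt : (W.quadraticTwist (NumberField.discr K : ℚ)).IsElliptic :=
    W.isElliptic_quadraticTwist hD0
  obtain ⟨Cd, hCd⟩ := hasGlobalMinimalModel_rat_holds (W.quadraticTwist (NumberField.discr K : ℚ))
  haveI := hCd
  exact missingLowerBoundAt_of_indexLowerBoundAt_of_surj_odd W p K Dt H ι P (hGZ _ W K) (hKo _ W K)
    hWu hGZK hmod hr hp2 hmult hsurj hK hodd hpd hHN hP hc hμ hLt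
    (Cd • W.quadraticTwist (NumberField.discr K : ℚ)) Cd rfl
    (indexLowerBoundAt_of_heegner_of_onTreeUpperInputs W p _ K Dt H ι P (hGZ _ W K) (hKo _ W K)
      hmod hp5 hr hmult rfl hK hHN hLt hP
      (hLC _ K Dt H ι P hX' hp5 hsurj rfl hK hodd hpd hμ hHN hLt hP hc hPinf)
      (hA _ Dt H ι P hX' hp5 hsurj rfl hK hodd hpd hμ hHN hLt hP hc hPinf))

/-- **A1 — ANY Locus pair (`(ram) ∧ p ∤ ∏_ℓ c_ℓ(E)`; 2 093 111 ‖ 61 629): `BSD(E,p)` from published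
facts and THE open input over ONE admissible field — nothing else typed.** Lower half: the previous
theorem (`Surj` from (ram)); upper half: the THEOREM `missingUpperBoundAt_of_classX11b_of_ram_of_not_dvd`
(Kolyvagin 1990 + Gross–Zagier + Skinner 2016 Thm. C for the twist); assembly
`Typed.bsdp_of_missingPPartAt`. Gen 18's `P2.bsdp_of_locus_endState` asked the input at every field.
CONDITIONAL on the input over `K`; nothing booked.
[cite: Castella2018Erratum, (2.4), Thm. 1.1 (pp. 1, 4)] [cite: Castella2018, Thms. 3.1–3.2, §5]
[cite: Skinner2016PacificMC, Thm. C (§1)] [cite: McCallumLMS1991, §1 Theorem (Kolyvagin), p. 296]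
[cite: Miller2011LMS, Def. 1.1] -/
theorem P2.bsdp_of_locus_of_openInputAtField
    (hGZ : ∀ (N : ℕ) [NeZero N] (W : WeierstrassCurve ℚ) (K : Type) [Field K] [NumberField K],
      gross_zagier N W K)
    (hKo : ∀ (N : ℕ) [NeZero N] (W : WeierstrassCurve ℚ) (K : Type) [Field K] [NumberField K],
      kolyvagin N W K)
    (hB : ∀ (N : ℕ) [NeZero N] (W : WeierstrassCurve ℚ) (K : Type) [Field K] [NumberField K],
      Kolyvagin1990_padicValNat_card_sha_le N W K)
    (hSk : Skinner2016.thmC_padicValRat_bsd_rank_zero) (hWu : sha_dvd_analyticSha)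
    (hGZK : rank_eq_analyticRank_of_analyticRank_le_one) (hmod : hasEntireLFunction_rat)
    (hnf : exists_isNewformOf) (hHL : HoffsteinLuo1997_exists_twist_L_one_ne_zero)
    (hMaz : mazur_not_dvd_maninConstant_of_odd)
    (hPT : ∀ (K : Type) [Field K] [NumberField K], poitouTate_sum_localTatePairing_eq_zero K)
    (hEP : ∀ (K : Type) [Field K] [NumberField K] (v : HeightOneSpectrum (𝓞 K)),
      localEulerPoincareCharacteristic (v.adicCompletion K))
    -- ONE admissible field
    (hK : IsImaginaryQuadratic K) (hodd : Odd (NumberField.discr K))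
    (hpd : ¬ (p : ℤ) ∣ NumberField.discr K) (hμ : ¬ p ∣ Units.torsionOrder K)
    (hHN : SatisfiesHeegnerHypothesis (W.conductorNorm ℤ) K)
    (hLt : (W.quadraticTwist (NumberField.discr K : ℚ)).entireLFunction 1 ≠ 0)
    -- THE open input, over `K`
    (hA : P2.OpenInputOnTreeAtField W p K)
    -- the pair: on the Locus
    (hX : ClassX11b W p) (hp5 : 5 ≤ p) (hram : Ram W p) (htam : ¬ p ∣ W.tamagawaProduct) :
    BSDp W p := by
  have hsurj : Surj W p := surj_of_irr_of_ram W p hX.2.2.2 hram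
  refine Typed.bsdp_of_missingPPartAt W p hGZK (by rw [hX.1]) ?_
  exact Typed.missingPPartAt_of_lower_of_upper W p
    (P2.missingLowerBoundAt_of_openInputAtField W p hGZ hKo hWu hGZK hmod hnf hMaz hPT hEP hK hodd
      hpd hμ hHN hLt hA hX hp5 hsurj)
    (missingUpperBoundAt_of_classX11b_of_ram_of_not_dvd hGZ hKo hB hSk hGZK hmod hnf hHL hMaz
      integral_neronScaling_of_isGloballyMinimal_holds W p hX hram htam)

end OneField

/-! ### §3 Tightness per field: on the Locus the input over ANY admissible field is `BSD(E,p)` -/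

section Tight

variable (W : WeierstrassCurve ℚ) [W.IsElliptic] [W.IsGloballyMinimal] (p : ℕ) [Fact p.Prime]

/-- `BSD(E,p)` ⟹ the input over EVERY field, on (ram) pairs, given the control IDENTITY (PUB shape)
— gen 18's `P2.openInputOnTreeAt_of_bsdp_of_ram` read per field. [cite: Castella2018, Thm. 2.3 (p. 5), §5 (p. 12)]
[cite: Skinner2016PacificMC, Thm. C (§1)] -/
theorem P2.openInputOnTreeAtField_of_bsdp_of_ram
    (hGZ : ∀ (N : ℕ) [NeZero N] (W : WeierstrassCurve ℚ) (K : Type) [Field K] [NumberField K],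
      gross_zagier N W K)
    (hKo : ∀ (N : ℕ) [NeZero N] (W : WeierstrassCurve ℚ) (K : Type) [Field K] [NumberField K],
      kolyvagin N W K)
    (hSk : Skinner2016.thmC_padicValRat_bsd_rank_zero)
    (hGZK : rank_eq_analyticRank_of_analyticRank_le_one) (hmod : hasEntireLFunction_rat)
    (hC : P2ControlOnTreeAt W p) (hram : Ram W p) (hbsd : BSDp W p)
    (K : Type) [Field K] [NumberField K] : P2.OpenInputOnTreeAtField W p K :=
  P2.openInputOnTreeAtField_of_openInputOnTreeAt
    (P2.openInputOnTreeAt_of_bsdp_of_ram W p hGZ hKo hSk hGZK hmod hC hram hbsd)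

/-- **THE INPUT OVER ANY ADMISSIBLE FIELD ⟺ `BSD(E,p)` ON THE LOCUS**, given the published facts and
the PUB-shaped control identity `P2ControlOnTreeAt W p` (Cas18 Thm. 2.3 as an identity; used only in
`⟸`). Per-field form of gen 18's `P2.openInputOnTreeAt_iff_bsdp_of_locus`. CONDITIONAL bookkeeping;
nothing booked. [cite: Castella2018, Thm. 2.3 (p. 5), Thm. 3.2 (p. 9), §5 (p. 12)]
[cite: Castella2018Erratum, (2.4) (p. 4)] [cite: Skinner2016PacificMC, Thm. C (§1)] -/
theorem P2.openInputOnTreeAtField_iff_bsdp_of_locus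
    (hGZ : ∀ (N : ℕ) [NeZero N] (W : WeierstrassCurve ℚ) (K : Type) [Field K] [NumberField K],
      gross_zagier N W K)
    (hKo : ∀ (N : ℕ) [NeZero N] (W : WeierstrassCurve ℚ) (K : Type) [Field K] [NumberField K],
      kolyvagin N W K)
    (hB : ∀ (N : ℕ) [NeZero N] (W : WeierstrassCurve ℚ) (K : Type) [Field K] [NumberField K],
      Kolyvagin1990_padicValNat_card_sha_le N W K)
    (hSk : Skinner2016.thmC_padicValRat_bsd_rank_zero) (hWu : sha_dvd_analyticSha)
    (hGZK : rank_eq_analyticRank_of_analyticRank_le_one) (hmod : hasEntireLFunction_rat)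
    (hnf : exists_isNewformOf) (hHL : HoffsteinLuo1997_exists_twist_L_one_ne_zero)
    (hMaz : mazur_not_dvd_maninConstant_of_odd)
    (hPT : ∀ (K : Type) [Field K] [NumberField K], poitouTate_sum_localTatePairing_eq_zero K)
    (hEP : ∀ (K : Type) [Field K] [NumberField K] (v : HeightOneSpectrum (𝓞 K)),
      localEulerPoincareCharacteristic (v.adicCompletion K))
    (hC : P2ControlOnTreeAt W p)
    {K : Type} [Field K] [NumberField K]
    (hK : IsImaginaryQuadratic K) (hodd : Odd (NumberField.discr K))
    (hpd : ¬ (p : ℤ) ∣ NumberField.discr K) (hμ : ¬ p ∣ Units.torsionOrder K)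
    (hHN : SatisfiesHeegnerHypothesis (W.conductorNorm ℤ) K)
    (hLt : (W.quadraticTwist (NumberField.discr K : ℚ)).entireLFunction 1 ≠ 0)
    (hX : ClassX11b W p) (hp5 : 5 ≤ p) (hram : Ram W p) (htam : ¬ p ∣ W.tamagawaProduct) :
    P2.OpenInputOnTreeAtField W p K ↔ BSDp W p :=
  ⟨fun hA ↦ P2.bsdp_of_locus_of_openInputAtField W p hGZ hKo hB hSk hWu hGZK hmod hnf hHL hMaz hPT
      hEP hK hodd hpd hμ hHN hLt hA hX hp5 hram htam,
    fun h ↦ P2.openInputOnTreeAtField_of_bsdp_of_ram W p hGZ hKo hSk hGZK hmod hC hram h K⟩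

/-- **ONE FIELD ⟺ EVERY FIELD on the Locus** (given the facts and the control identity): the
composite open input over ONE admissible field is EQUIVALENT to the class-wide input
`P2OpenInputOnTreeAt W p` (over all fields). The datum-direction analogue of gen 26's "the open
statement does not see the frame". CONDITIONAL bookkeeping; nothing booked.
[cite: Castella2018, Thm. 2.3 (p. 5), §5 (p. 12)] [cite: Castella2018Erratum, (2.4) (p. 4)] -/
theorem P2.openInputOnTreeAtField_iff_openInputOnTreeAt_of_locus
    (hGZ : ∀ (N : ℕ) [NeZero N] (W : WeierstrassCurve ℚ) (K : Type) [Field K] [NumberField K],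
      gross_zagier N W K)
    (hKo : ∀ (N : ℕ) [NeZero N] (W : WeierstrassCurve ℚ) (K : Type) [Field K] [NumberField K],
      kolyvagin N W K)
    (hB : ∀ (N : ℕ) [NeZero N] (W : WeierstrassCurve ℚ) (K : Type) [Field K] [NumberField K],
      Kolyvagin1990_padicValNat_card_sha_le N W K)
    (hSk : Skinner2016.thmC_padicValRat_bsd_rank_zero) (hWu : sha_dvd_analyticSha)
    (hGZK : rank_eq_analyticRank_of_analyticRank_le_one) (hmod : hasEntireLFunction_rat)
    (hnf : exists_isNewformOf) (hHL : HoffsteinLuo1997_exists_twist_L_one_ne_zero)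
    (hMaz : mazur_not_dvd_maninConstant_of_odd)
    (hPT : ∀ (K : Type) [Field K] [NumberField K], poitouTate_sum_localTatePairing_eq_zero K)
    (hEP : ∀ (K : Type) [Field K] [NumberField K] (v : HeightOneSpectrum (𝓞 K)),
      localEulerPoincareCharacteristic (v.adicCompletion K))
    (hC : P2ControlOnTreeAt W p)
    {K : Type} [Field K] [NumberField K]
    (hK : IsImaginaryQuadratic K) (hodd : Odd (NumberField.discr K))
    (hpd : ¬ (p : ℤ) ∣ NumberField.discr K) (hμ : ¬ p ∣ Units.torsionOrder K)
    (hHN : SatisfiesHeegnerHypothesis (W.conductorNorm ℤ) K)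
    (hLt : (W.quadraticTwist (NumberField.discr K : ℚ)).entireLFunction 1 ≠ 0)
    (hX : ClassX11b W p) (hp5 : 5 ≤ p) (hram : Ram W p) (htam : ¬ p ∣ W.tamagawaProduct) :
    P2.OpenInputOnTreeAtField W p K ↔ P2OpenInputOnTreeAt W p := by
  rw [P2.openInputOnTreeAtField_iff_bsdp_of_locus W p hGZ hKo hB hSk hWu hGZK hmod hnf hHL hMaz hPT
    hEP hC hK hodd hpd hμ hHN hLt hX hp5 hram htam,
    P2.openInputOnTreeAt_iff_bsdp_of_locus W p hGZ hKo hB hSk hWu hGZK hmod hnf hHL hMaz hPT hEP hC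
      hX hp5 hram htam]

end Tight

end Summit.BirchSwinnertonDyer.Rank1Residual.X11b

end
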